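import Summits.ValiantsHypothesis.ValiantsHypothesis.Theorems.PolyaContinuedMonotoneCoverHardBalExPure
import Summits.ValiantsHypothesis.ValiantsHypothesis.Theorems.PolyaContinuedMonotoneCoverHardLevelProfile

/-!
# Crux `MonotoneCoverHard` (stmt-ValiantsHypothesis-7421): BALEX DICHOTOMY — a balanced vertex set exists
unless one level carries more than `2n/3` of the variable edges

Closure of the BalEx lane (val-width-7421-p3 g0).  For a cover `(m, E, a)` of `per_n` (labels in
`{X j, 0, 1}`, `per_n = aeval a PM_E`; no Pfaffian hypothesis) and any level function `g` on its used
edges, let `c_ℓ` be the (matching-independent, `card_level_var_eq`) number of variable edges of a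
weight-nonzero perfect matching leaving row level `ℓ`.  `exists_balanced_or_superfat`: EITHER some vertex
set `S` is balanced for every weight-nonzero perfect matching (`n ≤ 3·inside ≤ 2n`, the BALEX clause of
the calibrated bet `stub_fewStateCut ⟺ WeakExp ∧ BalEx`), OR some level is SUPER-FAT: `3 c_ℓ > 2n`.
The threshold is `2n/3`, not `n/3`: a level with `n/3 ≤ c_ℓ ≤ 2n/3` is itself balanced through the BAND
`S = R_ℓ ∪ C_{ℓ+1}`; if all `c_ℓ < n/3`, a PREFIX `S = {rows of level < h} ∪ {columns of level ≤ h}`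
is balanced (as in val-width-7421-p2's `exists_balanced_level`).  With `…OneLevel.lean` (a single
variable level — necessarily super-fat — is impossible for Pfaffian covers) this leaves BalEx open only
for Pfaffian covers with a super-fat level next to thinner ones.  VP ≠ VNP is not moved.  No definitions.
-/

namespace Summit.ValiantsHypothesis.ValiantsHypothesis.Theorems.PolyaContinuedMonotoneCoverHard

-- summit = sub-problem name (single-conjunct summit, D-0017 layout), so the namespace repeats it
set_option linter.dupNamespace false

open scoped Classical
open Finset

/-- **BalEx dichotomy.**  For a cover of `per_n` with a level function `g` on its used edges: either a
vertex set balanced for all weight-nonzero perfect matchings exists, or some row level emits more than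
`2n/3` variable edges in every weight-nonzero perfect matching. -/
theorem exists_balanced_or_superfat {m n : ℕ} (E : Finset (Fin m × Fin m))
    (a : Fin m × Fin m → MvPolynomial (Fin n × Fin n) ℂ)
    (ha : ∀ e, (∃ j, a e = MvPolynomial.X j) ∨ a e = 0 ∨ a e = 1)
    (hper : Literature.Computability.AlgebraicComplexity.perPoly (Fin n) ℂ =
      MvPolynomial.aeval a (Matrix.of fun i j => if (i, j) ∈ E then MvPolynomial.X (i, j) else 0 :
          Matrix (Fin m) (Fin m) (MvPolynomial (Fin m × Fin m) ℂ)).permanent)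
    (g : Fin m ⊕ Fin m → ℕ)
    (hg : ∀ τ : Equiv.Perm (Fin m), (∀ i, (i, τ i) ∈ E ∧ a (i, τ i) ≠ 0) → ∀ i,
      ((∃ k, a (i, τ i) = MvPolynomial.X k) → g (Sum.inr (τ i)) = g (Sum.inl i) + 1) ∧
      ((¬ ∃ k, a (i, τ i) = MvPolynomial.X k) → g (Sum.inr (τ i)) = g (Sum.inl i))) :
    (∃ S : Finset (Fin m ⊕ Fin m),
      ∀ τ : Equiv.Perm (Fin m), (∀ i, (i, τ i) ∈ E ∧ a (i, τ i) ≠ 0) →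
        n ≤ 3 * (univ.filter fun i : Fin m =>
            Sum.inl i ∈ S ∧ Sum.inr (τ i) ∈ S ∧ ∃ j, a (i, τ i) = MvPolynomial.X j).card ∧
        3 * (univ.filter fun i : Fin m =>
            Sum.inl i ∈ S ∧ Sum.inr (τ i) ∈ S ∧ ∃ j, a (i, τ i) = MvPolynomial.X j).card ≤ 2 * n) ∨
    (∃ ℓ : ℕ, ∀ τ : Equiv.Perm (Fin m), (∀ i, (i, τ i) ∈ E ∧ a (i, τ i) ≠ 0) →
      2 * n < 3 * (univ.filter fun i : Fin m =>
        (∃ k, a (i, τ i) = MvPolynomial.X k) ∧ g (Sum.inl i) = ℓ).card) := by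
  by_cases hex : ∃ τ₀ : Equiv.Perm (Fin m), ∀ i, (i, τ₀ i) ∈ E ∧ a (i, τ₀ i) ≠ 0
  swap
  · exact Or.inl ⟨∅, fun τ hτ => absurd ⟨τ, hτ⟩ hex⟩
  obtain ⟨τ₀, hτ₀⟩ := hex
  -- widths and prefix counts are matching-independent
  have hF : ∀ τ : Equiv.Perm (Fin m), (∀ i, (i, τ i) ∈ E ∧ a (i, τ i) ≠ 0) → ∀ ℓ,
      (univ.filter fun i : Fin m => (∃ k, a (i, τ i) = MvPolynomial.X k) ∧ g (Sum.inl i) = ℓ).card =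
        (univ.filter fun i : Fin m =>
          (∃ k, a (i, τ₀ i) = MvPolynomial.X k) ∧ g (Sum.inl i) = ℓ).card :=
    fun τ hτ ℓ => by
      convert card_level_var_eq (fun i j => ∃ k, a (i, j) = MvPolynomial.X k) g τ τ₀
        (hg τ hτ) (hg τ₀ hτ₀) ℓ
  have hP : ∀ τ : Equiv.Perm (Fin m), (∀ i, (i, τ i) ∈ E ∧ a (i, τ i) ≠ 0) → ∀ h : ℕ,
      (univ.filter fun i : Fin m => (∃ k, a (i, τ i) = MvPolynomial.X k) ∧ g (Sum.inl i) < h).card =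
        (univ.filter fun i : Fin m =>
          (∃ k, a (i, τ₀ i) = MvPolynomial.X k) ∧ g (Sum.inl i) < h).card :=
    fun τ hτ h => by
      convert card_var_levelPred_eq (fun i j => ∃ k, a (i, j) = MvPolynomial.X k) g τ τ₀
        (hg τ hτ) (hg τ₀ hτ₀) (· < h)
  -- notation-free abbreviations for the reference matching
  set F : ℕ → ℕ := fun ℓ => (univ.filter fun i : Fin m =>
    (∃ k, a (i, τ₀ i) = MvPolynomial.X k) ∧ g (Sum.inl i) = ℓ).card with hFdef
  set P : ℕ → ℕ := fun h => (univ.filter fun i : Fin m =>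
    (∃ k, a (i, τ₀ i) = MvPolynomial.X k) ∧ g (Sum.inl i) < h).card with hPdef
  by_cases hA : ∃ ℓ, n ≤ 3 * F ℓ ∧ 3 * F ℓ ≤ 2 * n
  · -- a moderately fat level: the band `R_ℓ ∪ C_{ℓ+1}` is balanced
    obtain ⟨ℓ, hℓ⟩ := hA
    refine Or.inl ⟨univ.filter fun v => Sum.elim (fun i => g (Sum.inl i) = ℓ)
      (fun j => g (Sum.inr j) = ℓ + 1) v, fun τ hτ => ?_⟩
    have heq : (univ.filter fun i : Fin m =>
        Sum.inl i ∈ (univ.filter fun v => Sum.elim (fun i => g (Sum.inl i) = ℓ)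
          (fun j => g (Sum.inr j) = ℓ + 1) v) ∧
        Sum.inr (τ i) ∈ (univ.filter fun v => Sum.elim (fun i => g (Sum.inl i) = ℓ)
          (fun j => g (Sum.inr j) = ℓ + 1) v) ∧ ∃ j, a (i, τ i) = MvPolynomial.X j) =
        univ.filter fun i : Fin m => (∃ k, a (i, τ i) = MvPolynomial.X k) ∧ g (Sum.inl i) = ℓ := by
      ext i
      simp only [mem_filter, mem_univ, true_and, Sum.elim_inl, Sum.elim_inr]
      constructor
      · rintro ⟨h1, -, h3⟩; exact ⟨h3, h1⟩
      · rintro ⟨h3, h1⟩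
        have := (hg τ hτ i).1 h3
        exact ⟨h1, by omega, h3⟩
    rw [heq, hF τ hτ ℓ]
    exact hℓ
  by_cases hB : ∃ ℓ, 2 * n < 3 * F ℓ
  · -- a super-fat level
    obtain ⟨ℓ, hℓ⟩ := hB
    exact Or.inr ⟨ℓ, fun τ hτ => by rw [hF τ hτ ℓ]; exact hℓ⟩
  -- all levels thin: `3 F ℓ < n`
  have hthin : ∀ ℓ, 3 * F ℓ < n := by
    intro ℓ
    by_contra h
    have h1 : ¬ (2 * n < 3 * F ℓ) := fun h' => hB ⟨ℓ, h'⟩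
    exact hA ⟨ℓ, by omega, by omega⟩
  -- prefix counts climb from `0` to `n` in thin steps
  have hP0 : P 0 = 0 := by
    rw [hPdef]
    simp
  have hPstep : ∀ h, P (h + 1) = P h + F h := by
    intro h
    rw [hPdef, hFdef]
    simp only
    rw [← card_union_of_disjoint]
    · congr 1
      ext i
      simp only [mem_filter, mem_univ, true_and, mem_union]
      constructor
      · rintro ⟨hv, hlt⟩
        rcases Nat.lt_succ_iff_lt_or_eq.1 hlt with h' | h'
        · exact Or.inl ⟨hv, h'⟩
        · exact Or.inr ⟨hv, h'⟩
      · rintro (⟨hv, h'⟩ | ⟨hv, h'⟩)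
        · exact ⟨hv, by omega⟩
        · exact ⟨hv, by omega⟩
    · exact disjoint_filter.2 fun i _ h1 h2 => by omega
  have hPtop : P ((univ.sup fun i : Fin m => g (Sum.inl i)) + 1) = n := by
    rw [hPdef]
    simp only
    have h1 : (univ.filter fun i : Fin m => (∃ k, a (i, τ₀ i) = MvPolynomial.X k) ∧
        g (Sum.inl i) < (univ.sup fun i : Fin m => g (Sum.inl i)) + 1) =
        univ.filter fun i : Fin m => ∃ j, a (i, τ₀ i) = MvPolynomial.X j :=
      filter_congr fun i _ => ⟨fun h => h.1, fun h => ⟨h, Nat.lt_succ_of_le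
        (Finset.le_sup (f := fun i : Fin m => g (Sum.inl i)) (mem_univ i))⟩⟩
    rw [h1]
    exact card_var_eq E a ha hper τ₀ hτ₀
  have hexists : ∃ h, n ≤ 3 * P h := ⟨_, by rw [hPtop]; omega⟩
  set h₀ := Nat.find hexists with hh₀
  have hh₀spec : n ≤ 3 * P h₀ := Nat.find_spec hexists
  have hwin : n ≤ 3 * P h₀ ∧ 3 * P h₀ ≤ 2 * n := by
    refine ⟨hh₀spec, ?_⟩
    rcases Nat.eq_zero_or_eq_succ_pred h₀ with h0 | hs
    · rw [h0, hP0]; exact Nat.zero_le _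
    · have hmin : ¬ n ≤ 3 * P (h₀ - 1) := Nat.find_min hexists (by omega)
      rw [hs, hPstep]
      have := hthin (h₀ - 1)
      have h3 : h₀.pred = h₀ - 1 := rfl
      rw [h3]
      omega
  -- the prefix cut at `h₀`
  refine Or.inl ⟨univ.filter fun v => Sum.elim (fun i => g (Sum.inl i) < h₀)
    (fun j => g (Sum.inr j) ≤ h₀) v, fun τ hτ => ?_⟩
  have heq : (univ.filter fun i : Fin m =>
      Sum.inl i ∈ (univ.filter fun v => Sum.elim (fun i => g (Sum.inl i) < h₀)
        (fun j => g (Sum.inr j) ≤ h₀) v) ∧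
      Sum.inr (τ i) ∈ (univ.filter fun v => Sum.elim (fun i => g (Sum.inl i) < h₀)
        (fun j => g (Sum.inr j) ≤ h₀) v) ∧ ∃ j, a (i, τ i) = MvPolynomial.X j) =
      univ.filter fun i : Fin m => (∃ k, a (i, τ i) = MvPolynomial.X k) ∧ g (Sum.inl i) < h₀ := by
    ext i
    simp only [mem_filter, mem_univ, true_and, Sum.elim_inl, Sum.elim_inr]
    constructor
    · rintro ⟨h1, -, h3⟩; exact ⟨h3, h1⟩
    · rintro ⟨h3, h1⟩
      have := (hg τ hτ i).1 h3
      exact ⟨h1, by omega, h3⟩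
  rw [heq, hP τ hτ h₀]
  exact hwin

end Summit.ValiantsHypothesis.ValiantsHypothesis.Theorems.PolyaContinuedMonotoneCoverHard
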